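import Summits.AtomisticToContinuum.HydrodynamicLimit.Theorems.ImplosionDichotomyHydroLimitProfilewiseBandKcwfQReduction
import Summits.AtomisticToContinuum.HydrodynamicLimit.Theorems.ImplosionDichotomyHydroLimitProfilewiseBandGuardedWindowClauseS
import Summits.AtomisticToContinuum.HydrodynamicLimit.Theorems.ImplosionDichotomyHydroLimitProfilewiseBandGuardedCubicChannelS
import Summits.AtomisticToContinuum.HydrodynamicLimit.Theorems.ImplosionDichotomyHydroLimitProfilewiseBandGuardedWindowContinuity
import Summits.AtomisticToContinuum.HydrodynamicLimit.Theorems.ImplosionDichotomyHydroLimitProfilewiseBandGuardedLedgerEndD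
import Summits.AtomisticToContinuum.HydrodynamicLimit.Theorems.ImplosionDichotomyHydroLimitInBandSignedInputs
import Summits.AtomisticToContinuum.HydrodynamicLimit.Theorems.ImplosionDichotomyProfilewiseOfInBand
import HarnessLib

/-!
# Line `IdeatorOneSketch` ≡ `inherited_window_clock` — skeleton v20 (= v19 with its five plumbing stubs LANDED and closed in place): the true-law tail inputs GUARD-RELATIVISED
# crux `HydroLimitProfilewiseBand` (stmt-AtomisticToContinuum-17372), route ImplosionDichotomy

Lead `prover-line-stmt-AtomisticToContinuum-17372-c13-0` (continuation c13, line cycle 14), 2026-08-17T13:25Z–.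

v20 (14:1xZ): the five plumbing stubs of v19 are LANDED — p164749 `HydroLimitGuardedSeetTails.stub_energyCurrentTailsG` (+ helper
`stub_transferActivityTailsG`), p164817 `HydroLimitGuardedCubicChannelS.stub_cubicChannelRateSG`, p164883
`HydroLimitGuardedWindowContinuity.stub_windowContinuityInBandG`, p164926 `HydroLimitGuardedLedgerEndD.stub_ledgerEndDG`, p165168
`HydroLimitGuardedWindowClauseS.stub_windowClauseRateSG` — and closed in place by name (§3); registered stubs are back to TWO research
inputs: `stub_kcwuSharpPlus` (16659's, verbatim) and `stub_items4G = SEET_η ∧ LCTF ∧ EAT_η ∧ CAT_η`; rc 0 / 2 sorry; `_of` concludes the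
crux BY NAME.  The glue `Theorems/ImplosionDichotomyHydroLimitProfilewiseBandGuardedGlue.lean` (`hydroLimitInBand_of_guardedInputs`,
`hydroLimitProfilewiseBand_of_guardedInputs` = registered sub-goal and `--glue-by` decl, `hydrodynamicLimit_of_guardedInputs` = guarded
DOCK-Q, `clampedTransferDockOfInputsQ_of_guarded`, `hydroLimitProfilewiseBand_of_itemInputs'`) lands next.

WHAT CHANGED IN v19 SINCE v18 (= v17 = … = v13 Lean text; two registered stubs `stub_kcwuSharpPlus` ∧ `stub_items4`).
v13–v18 closed the crux modulo the kinetic input `stub_kcwuSharpPlus` (crux 16659's only stub, verbatim) and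
`stub_items4 = SEET (stmt-17701) ∧ LCTF (stmt-17691) ∧ EAT (stmt-17703) ∧ CAT (stmt-13734)`.  The three TRUE-LAW tail items SEET / EAT /
CAT are typed WITHOUT a packing guard — they are asked of every tied classical hs-Euler solution, however dense it becomes before `T`
(lead c10's audit (d), `KCWU-audit-c10.md`; the crux-strategist of 13734, `Cruxes/CollisionActivityTails/STRATEGY-CENSUS.md` §4.2: the
unguarded dense corner makes 13734's line import 4′ false-as-typed and blocks every proof of CAT) — whereas their consumers (9133, this
crux, DOCK-Q 18054) are GUARDED (`ρ_t(x) σ³ < η` on `[0,T)`).  The 13734 strategist asked the tenure planner to RESTATE CAT as its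
guard-relativised form CAT_η (`RESTATE-SPLIT-REQUEST.md`, text `CAT_eta.txt`) "conditionally on a re-check that the heart composes from
CAT_η".  v19 IS that re-check, in the kernel:

* `stub_items4` is RESHAPED into the strictly weaker registered stub
  `stub_items4G = SEET_η ∧ LCTF ∧ EAT_η ∧ CAT_η` (`HydroLimitGuardedInputs.{SuperExponentialEnergyTails,EnergyActivityTails,CollisionActivityTails}Guarded`,
  LANDED statements file `Theorems/ImplosionDichotomyHydroLimitProfilewiseBandGuardedInputsDefs.lean`, p164114; CAT_η byte-identical with
  `CAT_eta.txt`; each conjunct implied by its item, `…Guarded_of_unguarded`, so v18 ⟹ v19 stub by stub: `items4G_of_items4` below);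
* the FIVE plumbing steps of the in-band clock that consume the tails are re-run with the guard threaded through, as five registered
  PROVABLE stubs — `stub_energyCurrentTailsG` (ECT_η ⟸ SEET_η), `stub_cubicChannelRateSG` (signed rate cubic channel ⟸ SEET_η),
  `stub_windowClauseRateSG` (one-window ledger ⟸ guarded tails; uses TAT_η ⟸ CAT_η ∧ EAT_η, a helper of the first stub's file),
  `stub_windowContinuityInBandG` (window continuity with its own threshold `ηW` ⟸ CAT_η, EAT_η, ECT_η), `stub_ledgerEndDG` (ledger end over
  the guarded window continuity) — each a copy of the landed template with the packing threshold shrunk by one more `min` (work files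
  `work/Guarded{SeetTails,CubicChannelS,WindowClauseS,WindowContinuity,LedgerEndD}.lean` of this lead, rc 0 / 0 sorry against the tree
  with the statements inlined, being landed `--supports 17372` now that p164114 is in the tree);
* the composition `HydroLimitProfilewiseBand_of` = `profilewiseOfInBand_proof` ∘ `hydroLimitInBand_of_guardedStubs` concludes the crux
  BY NAME; `hydroLimitInBand_of_guardedStubs` is 9133 from the guarded inputs; the kinetic side (KCWF-Q ⟸ KCWUSharpPlus by the landed
  `kcwfQ_of_kcwuSharpPlus`, the four landed signed-band stubs) is untouched.

Registered stubs of v19 (7 = stubs_max): research — `stub_kcwuSharpPlus` (16659's, verbatim), `stub_items4G`; provable plumbing (this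
lead, files ready) — `stub_energyCurrentTailsG`, `stub_cubicChannelRateSG`, `stub_windowClauseRateSG`, `stub_windowContinuityInBandG`,
`stub_ledgerEndDG`.  Consequence for the planners once the five plumbing stubs land: the tenure restate CAT → CAT_η (and EAT → EAT_η,
SEET → SEET_η) is SAFE for every consumer — 9133, 17372 and the dock re-prove from the guarded items by the glue of this file — and the
`--glue-by` declaration for splitting this crux onto guarded children will be the landed `hydroLimitProfilewiseBand_of_guardedInputs`.

Inputs re-verified at 13:3xZ (ledger): cone 16659 / 18052 / 17701 / 17691 / 17703 / 13734 / 9133 all OPEN, unclaimed, stamps unchanged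
since c12; `Disproof.lean` md5 5e75c2dc… unchanged since 00:56Z (NO KILL, §5 Targets empty); TTRL library 0/0/0.  DISPROOF USED: §1
(tie, balance laws, smoothness, `0 < σ` load-bearing — consumed inside the composition), §2 `threshold_idle`, §3 `data_cap_is_no_cap`
(the guard acts only through compression at `t > 0` — exactly the regime the guard-relativisation removes from the INPUTS' scope while
the consumer keeps it as a hypothesis), §6 shape separation (constrains lines, not this composition).  16659's Disproof: NO KILL; its
load-bearing clauses are carried verbatim by `stub_kcwuSharpPlus`.  The v18…v13 history (leads c12…c8) is in `Cruxes/…/NOTES.md`.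
-/

noncomputable section

open MeasureTheory Filter Set Topology InformationTheory
open scoped ENNReal

namespace Summit.AtomisticToContinuum.HydrodynamicLimit.Cruxes.HydroLimitProfilewiseBand.IdeatorOneSketchLine

open Literature.MathematicalPhysics.KineticTheory Literature.Analysis.FluidPDE Literature.Analysis.FunctionSpaces
open Summit.AtomisticToContinuum.HydrodynamicLimit.Theses
open Summit.AtomisticToContinuum.HydrodynamicLimit.Theorems (profilewiseOfInBand_proof)
open Summit.AtomisticToContinuum.HydrodynamicLimit.Theorems.HydroLimitInBandSignedBand
  (KineticCurrentsLDAlongFamiliesQ BandShiftStatics KineticInstanceOrth CubicChannelRateS WindowClauseRateS kcwf_of_kcwfQ)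
open Summit.AtomisticToContinuum.HydrodynamicLimit.Theorems.HydroLimitProfilewiseBandKcwfQ (kcwfQ_of_kcwuSharpPlus)
open Summit.AtomisticToContinuum.HydrodynamicLimit.Theorems.HydroLimitGuardedInputs

/-! ## §1 The statements — LANDED: `Theorems.HydroLimitInBandSignedBand` (p145654: KCWF-Q, BandShiftStatics, KineticInstanceOrth) and
`Theorems.HydroLimitGuardedInputs` (p164114: SEET_η, EAT_η, CAT_η, ECT_η, TAT_η, OneWindowLedgerRateD, CubicChannelRateSGuarded,
WindowClauseRateSGuarded, WindowContinuityInBandGuarded, LedgerEndDGuarded), opened above.  `KCWUSharpPlus` is written UNFOLDED in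
`stub_kcwuSharpPlus` (verbatim 16659's registered stub; no definition exists for it). -/

/-! ## §2 Research stubs (registered; `sorry` only in §2–§3) -/

/-- **STUB (conjecture-grade kinetic INPUT, shared verbatim with crux 16659's ONLY registered stub; NOT a worker target):
`KCWUSharpPlus`** — the pointwise kinetic-window LD rung with a NUMERIC tilt threshold for the class enlarged by its radial sector.
There is a packing guard `η₀ > 0` such that for all data bounds `(Θ, U, C, Λ)` and every `σ > 0` there is `β₀ = β₀(Θ,U,C,Λ,σ) > 0`
serving EVERY continuous profile triple within the bounds, every flow family, and every continuous weight quadruple `(A, b, G, K)`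
whose functional `F = A(x):w⊗w + (b(x)·w)G(x,|w|²) + K(x,|w|²)`, `w = v − u₀(x)`, has growth `C(1+‖v‖²)` and is orthogonal to
`1, v_j, ‖v‖²` under `M_{1,u₀(x),θ₀(x)}` at every `x`: for `|β| ≤ β₀` and `ε > 0` there are `τ₀` and, for `τ ≥ τ₀`, `N₀` with
`∫ exp(β Σᵢ w⁻¹∫₀ʷ F(Φ_r z i) dr) dλ^N ≤ exp(ε(N+1))` for `N ≥ N₀`, `w = τ(N+1)^{-1/3}`, `λ^N = localGibbsLaw σ a u₀ θ₀ N (Φ N)`.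
Necessary: `β₀ ≤ 1/(2ΘC)` (static Gaussian integrability; 16659's Disproof.lean). Implies 14662, 16659 (p137412), 18052 / KCWF-Q
(`kcwfQ_of_kcwuSharpPlus`). -/
theorem stub_kcwuSharpPlus :
    ∃ η₀ : ℝ, 0 < η₀ ∧ ∀ (Θ U C Λ : ℝ), 1 ≤ Θ → 0 ≤ U → 0 ≤ C → 1 ≤ Λ → ∀ σ : ℝ, 0 < σ →
        ∃ β₀ : ℝ, 0 < β₀ ∧
        ∀ (a θ₀ : T3 → ℝ) (u₀ : T3 → V3), Continuous a → Continuous θ₀ → Continuous u₀ →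
        (∀ x, Λ⁻¹ ≤ a x ∧ a x ≤ Λ) → (∀ x, Θ⁻¹ ≤ θ₀ x ∧ θ₀ x ≤ Θ) → (∀ x, ‖u₀ x‖ ≤ U) →
        σ ^ 3 * (⨆ x, a x) ≤ η₀ * ∫ x, a x →
        ∀ Φ : (N : ℕ) →
          HardSphereFlow (Torus.geometry (Fin 3)) (hsDiameter σ N) (N + 1),
        ∀ (A : T3 → Fin 3 → Fin 3 → ℝ) (b : T3 → V3) (G K : T3 × ℝ → ℝ),
        Continuous A → Continuous b → Continuous G → Continuous K →
        ∀ F : T3 × V3 → ℝ, (∀ y, F y =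
          (∑ j : Fin 3, ∑ k : Fin 3, A y.1 j k * ((y.2 - u₀ y.1) j * (y.2 - u₀ y.1) k)) +
            (∑ j : Fin 3, b y.1 j * (y.2 - u₀ y.1) j) * G (y.1, ‖y.2 - u₀ y.1‖ ^ 2) +
            K (y.1, ‖y.2 - u₀ y.1‖ ^ 2)) →
        (∀ y, |F y| ≤ C * (1 + ‖y.2‖ ^ 2)) →
        (∀ x, ∫ v, F (x, v) * localMaxwellian 1 (θ₀ x) (u₀ x) v = 0) →
        (∀ x (j : Fin 3), ∫ v, F (x, v) * v j * localMaxwellian 1 (θ₀ x) (u₀ x) v = 0) →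
        (∀ x, ∫ v, F (x, v) * ‖v‖ ^ 2 * localMaxwellian 1 (θ₀ x) (u₀ x) v = 0) →
        ∀ β : ℝ, |β| ≤ β₀ → ∀ ε : ℝ, 0 < ε → ∃ τ₀ : ℝ, 0 < τ₀ ∧ ∀ τ : ℝ, τ₀ ≤ τ →
        ∃ N₀ : ℕ, ∀ N : ℕ, N₀ ≤ N →
          ∫⁻ z, ENNReal.ofReal (Real.exp (β * ∑ i : Fin (N + 1),
              (τ * ((N : ℝ) + 1) ^ (-(1 / 3 : ℝ)))⁻¹ *
                ∫ r in (0 : ℝ)..(τ * ((N : ℝ) + 1) ^ (-(1 / 3 : ℝ))), F (((Φ N).flow r z) i)))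
            ∂(localGibbsLaw σ a u₀ θ₀ N (Φ N)) ≤
          ENNReal.ofReal (Real.exp (ε * ((N : ℝ) + 1))) := by
  sorry

/-- **STUB (research; the four ITEMS of route OneFlightGossipEngine with the three true-law tails GUARD-RELATIVISED; NOT a worker target —
each conjunct is an open problem, discharged by its (restated) item):** `SuperExponentialEnergyTailsGuarded` (SEET_η ⟸ stmt-17701),
`LocalClampedTransferLDAlongFamilies` (stmt-17691, unchanged — a reference-law statement with its own activity guard),
`EnergyActivityTailsGuarded` (EAT_η ⟸ stmt-17703), `CollisionActivityTailsGuarded` (CAT_η ⟸ stmt-13734; = `CAT_eta.txt`).  Strictly weaker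
than v18's `stub_items4` (`items4G_of_items4`). -/
theorem stub_items4G :
    SuperExponentialEnergyTailsGuarded ∧ OneFlightGossipEngine.LocalClampedTransferLDAlongFamilies ∧
      EnergyActivityTailsGuarded ∧ CollisionActivityTailsGuarded := by
  sorry

/-! ## §3 The five plumbing stubs of v19 — LANDED (this lead, p164749 / p164817 / p165168 / p164883 / p164926) and closed in place by name -/

/-- **STUB (plumbing) `stub_energyCurrentTailsG`: SEET_η ⟹ ECT_η** at rate one (template `ClampedTransferDockSeet.seet_imp_energyCurrentTails`,
guard passed through).  Work file `work/GuardedSeetTails.lean` (also lands the helper `stub_transferActivityTailsG : CAT_η → EAT_η → TAT_η`). -/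
theorem stub_energyCurrentTailsG : SuperExponentialEnergyTailsGuarded → EnergyCurrentTailsGuarded :=
  Theorems.HydroLimitGuardedSeetTails.stub_energyCurrentTailsG -- LANDED p164749

/-- **STUB (plumbing) `stub_cubicChannelRateSG`: the SIGNED rate cubic channel from SEET_η** (template
`HydroLimitInBandCubicChannelS.stub_cubicChannelRateS`, p146424; `ηQ` shrunk below `ηS`).  Work file `work/GuardedCubicChannelS.lean`. -/
theorem stub_cubicChannelRateSG : CubicChannelRateSGuarded :=
  Theorems.HydroLimitGuardedCubicChannelS.stub_cubicChannelRateSG -- LANDED p164817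

/-- **STUB (plumbing) `stub_windowClauseRateSG`: the one-window ledger at a rate, D-shape, over the signed channel, from the guarded tails**
(template `HydroLimitInBandWindowClauseS.stub_windowClauseRateS`, p146888; `ηw` shrunk below `ηT`, `ηE`).  Work file
`work/GuardedWindowClauseS.lean`. -/
theorem stub_windowClauseRateSG : WindowClauseRateSGuarded :=
  Theorems.HydroLimitGuardedWindowClauseS.stub_windowClauseRateSG -- LANDED p165168

/-- **STUB (plumbing) `stub_windowContinuityInBandG`: window continuity of the ledger from CAT_η, EAT_η, ECT_η**, with its own packing
threshold `ηW := min η₁ (min η₂ η₃)` (template `HydroLimitInBandContinuity.stub_windowContinuityInBand`, p118327-family; one-window estimate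
`abs_klDiv_window_sub_le` reused).  Work file `work/GuardedWindowContinuity.lean`. -/
theorem stub_windowContinuityInBandG :
    CollisionActivityTailsGuarded → EnergyActivityTailsGuarded → EnergyCurrentTailsGuarded → WindowContinuityInBandGuarded :=
  Theorems.HydroLimitGuardedWindowContinuity.stub_windowContinuityInBandG -- LANDED p164883

/-- **STUB (plumbing) `stub_ledgerEndDG`: the ledger end, D-shape, over the GUARDED window continuity** (template
`ClampedTransferDockLedgerEndD.stub_ledgerEndD`, p139514; `ηp` shrunk below `ηW`).  Work file `work/GuardedLedgerEndD.lean`. -/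
theorem stub_ledgerEndDG : LedgerEndDGuarded :=
  Theorems.HydroLimitGuardedLedgerEndD.stub_ledgerEndDG -- LANDED p164926

/-! ## §4 Stubs of v10–v18 that are THEOREMS (closed in place by name; unchanged) -/

/-- **KCWF-Q — CLOSED modulo `stub_kcwuSharpPlus`** (v13; `Theorems.HydroLimitProfilewiseBandKcwfQ.kcwfQ_of_kcwuSharpPlus`, lead c8;
= route item stmt-18052 by `kcwfQ_iff_routeItem`). -/
theorem stub_kcwfQ : KineticCurrentsLDAlongFamiliesQ :=
  kcwfQ_of_kcwuSharpPlus stub_kcwuSharpPlus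

/-- **CLOSED (p147261, 9133 wave; core `bandShift_param` p146899 by lead c7): the re-orthogonalised band truncation.** -/
theorem stub_bandShiftStatics : BandShiftStatics :=
  Theorems.HydroLimitInBandBandShift.stub_bandShiftStatics -- LANDED (9133 wave)

/-- **CLOSED (p146924, 9133-c17 wave): KC1 with the orthogonality of its cut-off exported.** -/
theorem stub_kineticInstanceOrth : KineticInstanceOrth :=
  Theorems.HydroLimitInBandKineticInstanceOrth.stub_kineticInstanceOrth -- LANDED p146924

/-! ## §5 Glue (sorry-free) -/

/-- **v18 ⟹ v19, stub by stub**: the unguarded item bundle gives the guarded one (`…Guarded_of_unguarded`, `η₀ := 1`). [folklore] -/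
theorem items4G_of_items4
    (h : OneFlightGossipEngine.SuperExponentialEnergyTails ∧ OneFlightGossipEngine.LocalClampedTransferLDAlongFamilies ∧
      OneFlightGossipEngine.EnergyActivityTails ∧ OneFlightGossipEngine.CollisionActivityTails) :
    SuperExponentialEnergyTailsGuarded ∧ OneFlightGossipEngine.LocalClampedTransferLDAlongFamilies ∧
      EnergyActivityTailsGuarded ∧ CollisionActivityTailsGuarded :=
  ⟨superExponentialEnergyTailsGuarded_of_unguarded h.1, h.2.1, energyActivityTailsGuarded_of_unguarded h.2.2.1,
    collisionActivityTailsGuarded_of_unguarded h.2.2.2⟩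

/-- **The uniform band (stmt-9133) from the GUARDED inputs as hypotheses** — v18's `hydroLimitInBand_of_reducedStubs` with the five
tail-consuming steps replaced by their guarded re-runs (§3): KCWF from KCWF-Q (`kcwf_of_kcwfQ`); ECT_η from SEET_η
(`stub_energyCurrentTailsG`); the one-window ledger `OneWindowLedgerRateD` by `stub_windowClauseRateSG` over the landed window estimate
`ClampedTransferDockRate.stub_windowEstimateRate` (p136014, solution-wise, reused as is), the guarded signed channel
`stub_cubicChannelRateSG`, the band statics, KC1-orth, KCWF-Q, SEET_η, LCTF, EAT_η, KCWF, CAT_η, ECT_η; the guarded window continuity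
`stub_windowContinuityInBandG`; the guarded Grönwall core by `stub_ledgerEndDG` with the landed a-priori bound (p109679); reduction
(p97252) and dock (p97115) unchanged — their input `GronwallCoreInBand` was guarded all along. [folklore] -/
theorem hydroLimitInBand_of_guardedStubs (hQ : KineticCurrentsLDAlongFamiliesQ)
    (hS : SuperExponentialEnergyTailsGuarded) (hL : OneFlightGossipEngine.LocalClampedTransferLDAlongFamilies)
    (hE : EnergyActivityTailsGuarded) (hC : CollisionActivityTailsGuarded)
    (hBS : BandShiftStatics) (hKO : KineticInstanceOrth) :
    ImplosionDichotomy.HydroLimitInBand := by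
  have hK : Theorems.HydroLimitInBandOfHeart.KineticCurrentsWindowLDFamily := kcwf_of_kcwfQ hQ
  have h₆ : EnergyCurrentTailsGuarded := stub_energyCurrentTailsG hS
  have hOW : OneWindowLedgerRateD :=
    stub_windowClauseRateSG Theorems.ClampedTransferDockRate.stub_windowEstimateRate stub_cubicChannelRateSG hBS hKO hQ hS hL hE hK hC h₆
  have hWC : WindowContinuityInBandGuarded := stub_windowContinuityInBandG hC hE h₆
  have hG : Theorems.HydroLimitInBandOfHeart.GronwallCoreInBand :=
    stub_ledgerEndDG hOW hWC Theorems.EntropyClockDock.ledgerAprioriBound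
  exact Theorems.hydroLimitInBand_of_relEntropyVanishingInBand
    (Theorems.EntropyClockDock.relEntropyVanishingInBand_of_gronwallCoreInBand hG)

/-- **`HydroLimitProfilewiseBand` from the stubs** — the composition the skeleton audit reads: `profilewiseOfInBand_proof` (p131525,
∃∀ ⇒ ∀∃) after `hydroLimitInBand_of_guardedStubs`, the research content entering ONLY through `stub_kcwuSharpPlus` (via `stub_kcwfQ`) and
`stub_items4G`; concludes the crux BY NAME. [folklore] -/
theorem HydroLimitProfilewiseBand_of : ImplosionDichotomy.HydroLimitProfilewiseBand := by
  obtain ⟨hS, hL, hE, hC⟩ := stub_items4G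
  exact profilewiseOfInBand_proof
    (hydroLimitInBand_of_guardedStubs stub_kcwfQ hS hL hE hC stub_bandShiftStatics stub_kineticInstanceOrth)

/-- **The conjunct itself from the v19 stubs** (`_root_.HydrodynamicLimit` and `ImplosionDichotomy.HydroLimitInBand` unfold to the same
term): the GUARDED form of DOCK-Q (stmt-18054). [folklore] -/
theorem hydrodynamicLimit_of : _root_.HydrodynamicLimit := by
  obtain ⟨hS, hL, hE, hC⟩ := stub_items4G
  exact hydroLimitInBand_of_guardedStubs stub_kcwfQ hS hL hE hC stub_bandShiftStatics stub_kineticInstanceOrth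

/-- **The crux factors through the ITEM stmt-9133** (`HydroLimitInBand`): the landed glue `profilewiseOfInBand_proof` (stmt-17373,
p131525) — the whole 17372-specific content of the line. [folklore] -/
theorem HydroLimitProfilewiseBand_of_inBand :
    ImplosionDichotomy.HydroLimitInBand → ImplosionDichotomy.HydroLimitProfilewiseBand :=
  fun h => profilewiseOfInBand_proof h

end Summit.AtomisticToContinuum.HydrodynamicLimit.Cruxes.HydroLimitProfilewiseBand.IdeatorOneSketchLine

end
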